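import Summits.BirchSwinnertonDyer.BirchSwinnertonDyer.Theorems.SylvesterTwoHeegnerIndexCMHalfTowerInvolution
import Summits.BirchSwinnertonDyer.BirchSwinnertonDyer.Theorems.SylvesterTwoHeegnerIndexCMHalfLayerL1OfDecomp
import Literature.NumberTheory.EllipticCurves.HasseWeilGoodReductionFrobeniusProofs
import HarnessLib

/-!
# (S10c, part 2) of leaf (L1) at `p ≡ 7 (mod 9)`, crux `UpperOffV0HSYPlus` (stmt-BirchSwinnertonDyer-19804): `stub_layerL1Seven`
# WITH THE TOWER FIXING REDUCED TO ITS SHIMURA-RECIPROCITY CORE (W2-b): «every involution of the decomposition group at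
# `w ∣ 3` fixes Hu–Shu–Yin's CM points»

Skeleton VARIANT M 406ca288e244d392; planner D531 (3) (#S10; no veto in advance on a clean census; byte-check vs
`stub_layerL1Seven` l.104–152).  #S10b (p688827) displays the tower fixing as `hTF′` = (W2-a) ∧ (W2-b) (memo two §67.2).
Here (W2-a) is DISCHARGED: from ONE local Frobenius `σ_v ∈ Γ_{K_v}` at the place `v ∋ 3` (tree
`exists_isArithFrobAt_localAbsIntegers`, `isArithFrobAt_resGalOfEmb`) put `F := res σ_v ∈ Γ_K`, `s := r₀(F)⁹ ∈ Gal(K[9p]/K)`,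
`φ_n := r_e(F)⁹ ∈ Gal(K[9pn]/K)` (`r₀, r_e` the restrictions along the embeddings): these are INVOLUTIONS (`ord ∣ 18`, #S10a /
part 1), `s ≠ 1` (its restriction to `K[p]` is the Frobenius involution of k-ty1 #21a), `s` fixes `∛3, ∛p` (part 1 §2), `φ_n`
restricts to `s` for EVERY `K`-embedding `e` of `K[9pn]` (part 1 §4: `Gal(K[9p]/K)` abelian), and `res(σ_v⁹)` realises `φ_n`
— so the only input left is that these involutions FIX THE CM POINTS, i.e. the displayed hypotheses

  `hW2b₁` : at the bottom `K[9p]`: every `τ ∈ Γ_{K_v}` (`v ∋ 3`) acting on `e(K[9p])` as an involution `s` fixes `y₁`;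
  `hW2b`  : at each Kolyvagin level `n`: every `τ ∈ Γ_{K_v}` acting on `e(K[9pn])` as an involution `φ` fixes `y_n`

(memo two §67.2 (W2-b): `Art_w(√−3)·y_n = y_n`, by Shimura reciprocity on `X₀(243)` and THEOREM C's 3-adic identity
`ρ(√−3) ∈ ℚ₃^×·U₀(3⁵)₃⟨A, W⟩` — kernel-certified residue step p452301; `D_w` has a unique involution, so «every involution of
`D_w`» = «`φ_w`»).

* `decompFixing_of_involutionFixing (Dt) : hW2b₁ → hW2b → hTF′`;
* **`layerL1Seven_of_named_of_flip_of_involutionFixing (Dt) (hdeg) (hD) (hES2) (hW2b₁) (hW2b)` : ⟨`stub_layerL1Seven`'s type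
  VERBATIM⟩**;
* `upperOffV0HSYPlus_of_named_of_flip_of_involutionFixing_of_tails … (htailFour) (htailSeven) : Theses.….UpperOffV0HSYPlus`.

HONEST LABEL: CONDITIONAL closures; `hW2b₁`/`hW2b` are the unrefereed cell lemma W2-b (desk (M-K3-7)); the tails are OPEN
stubs displayed as hypotheses; no ledger stub closed; items 19802/19804 OPEN; X12.CMAtTwo NOT proved; BSD is not proved by
any of this, for any curve.  `--supports stmt-BirchSwinnertonDyer-19804 --as helper`.
-/

set_option linter.dupNamespace false
set_option autoImplicit false

noncomputable section

open scoped Classical Pointwise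

namespace Summit.BirchSwinnertonDyer.BirchSwinnertonDyer.Theorems.SylvesterTwoCMHalf

open WeierstrassCurve Field NumberField IsDedekindDomain IsDedekindDomain.HeightOneSpectrum Finset Module
open Literature.NumberTheory.EllipticCurves Literature.NumberTheory.GaloisRepresentations
  Literature.NumberTheory.EllipticCurves.ModularForms
  Literature.NumberTheory.EllipticCurves.HuShuYin2019
  Literature.NumberTheory.EllipticCurves.KolyvaginCocycle
  Literature.NumberTheory.EllipticCurves.RingClassField
  Summit.BirchSwinnertonDyer.BirchSwinnertonDyer.Theses.SylvesterTwoHeegnerIndex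
  Summit.BirchSwinnertonDyer.BirchSwinnertonDyer.Theorems
  Summit.BirchSwinnertonDyer.BirchSwinnertonDyer.Theorems.SylvesterTwoCoupledDescentCebotarev
  Summit.BirchSwinnertonDyer.BirchSwinnertonDyer.Theorems.SylvesterTwoCMData
  Summit.BirchSwinnertonDyer.BirchSwinnertonDyer.Theorems.SylvesterTwoCMFlip
  Summit.BirchSwinnertonDyer.Rank1Residual.X11b Summit.BirchSwinnertonDyer.Rank1Residual.X11b.RingClassTower

set_option maxHeartbeats 1600000 in
/-- **(W2-a) discharged: `hW2b₁ → hW2b → hTF′`.**  The bottom involution `s` and the level involutions `φ_n` of the tower fixing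
are CONSTRUCTED as ninth powers of the restrictions of one local Frobenius `σ_v ∈ Γ_{K_v}` at `v ∋ 3`; they are involutions
(#S10a: the image of `Γ_{K_v}` has order `∣ 18`), `s ≠ 1` (k-ty1 #21a on `K[p]`), `s` fixes `∛3, ∛p` (part 1 §2), `φ_n|K[9p] = s`
(part 1 §4), `res(σ_v⁹)` realises `φ_n`; the displayed (W2-b) supplies `s·y₁ = y₁`, `φ_n·y_n = y_n`.
[cite: NeukirchANT1999, Ch. II §9 Prop. (9.6)] [cite: Cox2013, §9.A (9.1), Cor. 5.21] [cite: HuShuYin2019, §2.2 Prop. 2.4, §4.1]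
[cite: GrossLMS1991, §3] -/
theorem decompFixing_of_involutionFixing
    (Dt : ModularParametrizationData (⟨0, 0, 1, 0, -1⟩ : WeierstrassCurve ℚ) 243)
    (hW2b₁ : ∀ (p : ℕ), p.Prime → p % 9 = 7 → ∀ (K : Type) [Field K] [NumberField K] (ω : K), ω ^ 2 + ω + 1 = 0 →
      Module.finrank ℚ K = 2 → ∀ (ι : K →+* ℂ) (v : HeightOneSpectrum (𝓞 K)), ((3 : ℕ) : 𝓞 K) ∈ v.asIdeal →
      ∀ (e : ringClassField K ι (9 * p) →+* AlgebraicClosure K),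
        (∀ k : K, e (algebraMap K (ringClassField K ι (9 * p)) k) = algebraMap K (AlgebraicClosure K) k) →
      ∀ (y₁ : ((⟨0, 0, 1, 0, -1⟩ : WeierstrassCurve ℚ).baseChange (ringClassField K ι (9 * p))).toAffine.Point),
        Affine.Point.map (W' := (⟨0, 0, 1, 0, -1⟩ : WeierstrassCurve ℚ)) (ringClassField K ι (9 * p)).subtype.toRatAlgHom y₁ =
          Dt.φ (heegnerTau (81 * ((p : ℤ) ^ 2 + 4 * p + 16), -(9 * (4 * (p : ℤ) ^ 2 + 17 * p + 72)), 4 * (p : ℤ) ^ 2 + 18 * p + 81)) →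
      ∀ (τ : absoluteGaloisGroup (v.adicCompletion K)) (s : ringClassField K ι (9 * p) ≃ₐ[K] ringClassField K ι (9 * p)),
        (∀ x : ringClassField K ι (9 * p), (show AlgebraicClosure K ≃ₐ[K] AlgebraicClosure K from
          resGal (K := K) (v.adicCompletion K) τ) (e x) = e (s x)) → s * s = 1 →
        pointGalHom (⟨0, 0, 1, 0, -1⟩ : WeierstrassCurve ℚ) (ringClassField K ι (9 * p)) (s.restrictScalars ℚ) y₁ = y₁)
    (hW2b : ∀ (p : ℕ), p.Prime → p % 9 = 7 → ∀ (K : Type) [Field K] [NumberField K] (ω : K), ω ^ 2 + ω + 1 = 0 →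
      Module.finrank ℚ K = 2 → ∀ (ι : K →+* ℂ) (v : HeightOneSpectrum (𝓞 K)), ((3 : ℕ) : 𝓞 K) ∈ v.asIdeal →
      ∀ (n : ℕ), n ≠ 0 → (∀ q ∈ n.primeFactors, q % 3 = 2) →
      ∀ (e : ringClassField K ι (9 * p * n) →+* AlgebraicClosure K),
        (∀ k : K, e (algebraMap K (ringClassField K ι (9 * p * n)) k) = algebraMap K (AlgebraicClosure K) k) →
      ∀ (y : ((⟨0, 0, 1, 0, -1⟩ : WeierstrassCurve ℚ).baseChange (ringClassField K ι (9 * p * n))).toAffine.Point),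
        Affine.Point.map (W' := (⟨0, 0, 1, 0, -1⟩ : WeierstrassCurve ℚ)) (ringClassField K ι (9 * p * n)).subtype.toRatAlgHom y =
          Dt.φ (heegnerTau ((n : ℤ) ^ 2 * (81 * ((p : ℤ) ^ 2 + 4 * p + 16)),
            (n : ℤ) * (-(9 * (4 * (p : ℤ) ^ 2 + 17 * p + 72))), 4 * (p : ℤ) ^ 2 + 18 * p + 81)) →
      ∀ (τ : absoluteGaloisGroup (v.adicCompletion K))
        (φ : ringClassField K ι (9 * p * n) ≃ₐ[K] ringClassField K ι (9 * p * n)),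
        (∀ x : ringClassField K ι (9 * p * n), (show AlgebraicClosure K ≃ₐ[K] AlgebraicClosure K from
          resGal (K := K) (v.adicCompletion K) τ) (e x) = e (φ x)) → φ * φ = 1 →
        pointGalHom (⟨0, 0, 1, 0, -1⟩ : WeierstrassCurve ℚ) (ringClassField K ι (9 * p * n)) (φ.restrictScalars ℚ) y = y) :
    ∀ (p : ℕ), p.Prime → p % 9 = 7 → ∀ (K : Type) [Field K] [NumberField K] (ω : K), ω ^ 2 + ω + 1 = 0 →
      Module.finrank ℚ K = 2 → ∀ (ι : K →+* ℂ) (c₃ cp : ringClassField K ι (9 * p)), c₃ ^ 3 = 3 →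
      cp ^ 3 = (p : ringClassField K ι (9 * p)) →
      ∀ (y₁ : ((⟨0, 0, 1, 0, -1⟩ : WeierstrassCurve ℚ).baseChange (ringClassField K ι (9 * p))).toAffine.Point),
        Affine.Point.map (W' := (⟨0, 0, 1, 0, -1⟩ : WeierstrassCurve ℚ)) (ringClassField K ι (9 * p)).subtype.toRatAlgHom y₁ =
          Dt.φ (heegnerTau (81 * ((p : ℤ) ^ 2 + 4 * p + 16), -(9 * (4 * (p : ℤ) ^ 2 + 17 * p + 72)), 4 * (p : ℤ) ^ 2 + 18 * p + 81)) →
      ∃ s : ringClassField K ι (9 * p) ≃ₐ[K] ringClassField K ι (9 * p), s ≠ 1 ∧ s * s = 1 ∧ s c₃ = c₃ ∧ s cp = cp ∧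
        pointGalHom (⟨0, 0, 1, 0, -1⟩ : WeierstrassCurve ℚ) (ringClassField K ι (9 * p)) (s.restrictScalars ℚ) y₁ = y₁ ∧
        ∀ (n : ℕ), n ≠ 0 → (∀ q ∈ n.primeFactors, q % 3 = 2) →
          ∀ (hle : ringClassField K ι (9 * p) ≤ ringClassField K ι (9 * p * n))
            (e : ringClassField K ι (9 * p * n) →+* AlgebraicClosure K),
            (∀ k : K, e (algebraMap K (ringClassField K ι (9 * p * n)) k) = algebraMap K (AlgebraicClosure K) k) →
          ∀ (y : ((⟨0, 0, 1, 0, -1⟩ : WeierstrassCurve ℚ).baseChange (ringClassField K ι (9 * p * n))).toAffine.Point),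
            Affine.Point.map (W' := (⟨0, 0, 1, 0, -1⟩ : WeierstrassCurve ℚ)) (ringClassField K ι (9 * p * n)).subtype.toRatAlgHom y =
              Dt.φ (heegnerTau ((n : ℤ) ^ 2 * (81 * ((p : ℤ) ^ 2 + 4 * p + 16)),
                (n : ℤ) * (-(9 * (4 * (p : ℤ) ^ 2 + 17 * p + 72))), 4 * (p : ℤ) ^ 2 + 18 * p + 81)) →
          ∃ φ : ringClassField K ι (9 * p * n) ≃ₐ[K] ringClassField K ι (9 * p * n),
            (∀ x : ringClassField K ι (9 * p), φ (RingClassField.inclusion ι hle x) = RingClassField.inclusion ι hle (s x)) ∧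
            pointGalHom (⟨0, 0, 1, 0, -1⟩ : WeierstrassCurve ℚ) (ringClassField K ι (9 * p * n)) (φ.restrictScalars ℚ) y = y ∧
            φ * φ = 1 ∧
            ∀ (v : HeightOneSpectrum (𝓞 K)), ((3 : ℕ) : 𝓞 K) ∈ v.asIdeal →
              ∃ τ : absoluteGaloisGroup (v.adicCompletion K),
                ∀ x : ringClassField K ι (9 * p * n), (show AlgebraicClosure K ≃ₐ[K] AlgebraicClosure K from
                  resGal (K := K) (v.adicCompletion K) τ) (e x) = e (φ x) := by
  intro p hp hp7 K _ _ ω hω h2 ι c₃ cp hc₃ hcp y₁ hy₁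
  have hK := JZero.isImaginaryQuadratic_of_sq_add_self_add_one hω h2
  have hp3 : p % 3 = 1 := by omega
  have hp0 : p ≠ 0 := hp.ne_zero
  have hp3' : ¬ 3 ∣ p := fun h ↦ by have := Nat.mod_eq_zero_of_dvd h; omega
  have h9p0 : 9 * p ≠ 0 := mul_ne_zero (by norm_num) hp0
  haveI := (finiteDimensional_and_isGalois_ringClassField hK ι h9p0).1
  haveI := (finiteDimensional_and_isGalois_ringClassField hK ι h9p0).2
  haveI := (finiteDimensional_and_isGalois_ringClassField hK ι hp0).1
  haveI := (finiteDimensional_and_isGalois_ringClassField hK ι hp0).2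
  -- ### the place `v₀ ∋ 3`, a local Frobenius `σ`, the global Frobenius `F = res σ`
  obtain ⟨v₀, hv₀⟩ := exists_heightOneSpectrum_three_mem (K := K)
  obtain ⟨𝔐, h𝔐⟩ := v₀.localPrimesAbove_nonempty
  obtain ⟨σ, hσ⟩ := v₀.exists_isArithFrobAt_localAbsIntegers h𝔐
  have h𝔓 := v₀.primeBelow_mem_primesAbove (ι := closureEmb (K := K) (v₀.adicCompletion K)) h𝔐
  set F : absoluteGaloisGroup K := resGal (K := K) (v₀.adicCompletion K) σ with hFdef
  have hF : IsArithFrobAt (𝓞 K) F (v₀.primeBelow (closureEmb (K := K) (v₀.adicCompletion K)) 𝔐) :=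
    isArithFrobAt_resGalOfEmb h𝔐 (closureEmb (K := K) (v₀.adicCompletion K)) hσ
  have hres9 : resGal (K := K) (v₀.adicCompletion K) (σ ^ 9) = F ^ 9 := map_pow _ σ 9
  -- ### an embedding of the bottom `K[9p]`, its restriction, and `s := r₀(F)⁹`
  obtain ⟨emb, hembK, -⟩ := exists_coherent_emb (K := K) ι
  obtain ⟨r₀, hr₀, hr₀surj, -⟩ := exists_restrictHom hK ι h9p0 (emb (9 * p)) (hembK _)
  obtain ⟨P₀, hP₀, hP₀mem⟩ := exists_decompositionBound_three_of_dvd hω h2 ι hp hp3 hp3' (dvd_refl p) v₀ hv₀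
    (emb (9 * p)) (hembK _) r₀ hr₀ hr₀surj
  set s : ringClassField K ι (9 * p) ≃ₐ[K] ringClassField K ι (9 * p) := r₀ (F ^ 9) with hsdef
  have hs9 : s = r₀ F ^ 9 := map_pow r₀ F 9
  have hs2 : s * s = 1 := by
    have h18 : r₀ F ^ 18 = 1 :=
      orderOf_dvd_iff_pow_eq_one.mp ((Subgroup.orderOf_dvd_natCard P₀ (hP₀mem σ)).trans hP₀)
    rw [hs9, ← pow_add]; exact h18
  have hss : ∀ x, s (s x) = x := fun x ↦ by rw [← AlgEquiv.mul_apply, hs2, AlgEquiv.one_apply]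
  -- ### `s ≠ 1`: its restriction to `K[p]` is the Frobenius involution `≠ 1` (k-ty1 #21a)
  have hlep : ringClassField K ι p ≤ ringClassField K ι (9 * p) := ringClassField_mono hK ι (Dvd.intro_left 9 rfl) h9p0
  set ep : ringClassField K ι p →+* AlgebraicClosure K := (emb (9 * p)).comp (RingClassField.inclusion ι hlep) with hepdef
  have hep : ∀ k : K, ep (algebraMap K (ringClassField K ι p) k) = algebraMap K (AlgebraicClosure K) k := fun k ↦ by
    show emb (9 * p) (RingClassField.inclusion ι hlep (algebraMap K (ringClassField K ι p) k)) = _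
    rw [(RingClassField.inclusion ι hlep).commutes, hembK]
  obtain ⟨rp, hrp, -, -⟩ := exists_restrictHom hK ι hp0 ep hep
  obtain ⟨σ₀, -, hσ₀1, hσ₀2, hσ₀F⟩ := JZero.exists_involution_apply_emb_eq_of_isArithFrobAt_three hω h2 ι v₀ hv₀ hp3' hp
    hp3 (dvd_refl p) ep hep h𝔓 hF
  have hrpF : ∀ x, rp F x = σ₀ x := fun x ↦ ep.injective (by rw [← hrp]; exact hσ₀F x)
  have hrpF9 : rp F ^ 9 = rp F := by
    have h2' : rp F ^ 2 = 1 := by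
      refine AlgEquiv.ext fun x ↦ ?_
      rw [pow_two, AlgEquiv.mul_apply, hrpF, hrpF, ← AlgEquiv.mul_apply, hσ₀2]; rfl
    rw [show (9 : ℕ) = 2 * 4 + 1 from rfl, pow_succ, pow_mul, h2', one_pow, one_mul]
  have hincl : ∀ (g : absoluteGaloisGroup K) (x : ringClassField K ι p),
      r₀ g (RingClassField.inclusion ι hlep x) = RingClassField.inclusion ι hlep (rp g x) :=
    restrictHom_apply_inclusion hK ι hp0 hlep ep hep rp hrp (emb (9 * p)) (hembK _) r₀ hr₀
  have hs1 : s ≠ 1 := by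
    intro h1
    apply hσ₀1
    refine AlgEquiv.ext fun x ↦ ?_
    have hx := hincl (F ^ 9) x
    rw [← hsdef, h1, AlgEquiv.one_apply, map_pow, hrpF9, hrpF] at hx
    rw [AlgEquiv.one_apply]
    exact ((RingClassField.inclusion ι hlep).injective hx).symm
  -- ### `s` fixes `∛3, ∛p` (part 1 §2) and `y₁` (displayed (W2-b) at the bottom)
  have hω' : (algebraMap K (ringClassField K ι (9 * p)) ω) ^ 2 + algebraMap K (ringClassField K ι (9 * p)) ω + 1 = 0 := by
    have h := congrArg (algebraMap K (ringClassField K ι (9 * p))) hω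
    rwa [map_add, map_add, map_pow, map_one, map_zero] at h
  have hsω : s.toRingEquiv (algebraMap K (ringClassField K ι (9 * p)) ω) = algebraMap K (ringClassField K ι (9 * p)) ω :=
    s.commutes ω
  have hss' : ∀ x, s.toRingEquiv (s.toRingEquiv x) = x := hss
  have hs3 : s c₃ = c₃ :=
    apply_eq_self_of_sq_of_pow_three_eq hω' s.toRingEquiv hss' hsω hc₃ (by exact map_ofNat s 3) three_ne_zero
  have hsp : s cp = cp :=
    apply_eq_self_of_sq_of_pow_three_eq hω' s.toRingEquiv hss' hsω hcp (by exact map_natCast s p)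
      (Nat.cast_ne_zero.mpr hp0)
  have hsy : pointGalHom (⟨0, 0, 1, 0, -1⟩ : WeierstrassCurve ℚ) (ringClassField K ι (9 * p)) (s.restrictScalars ℚ) y₁ = y₁ :=
    hW2b₁ p hp hp7 K ω hω h2 ι v₀ hv₀ (emb (9 * p)) (hembK _) y₁ hy₁ (σ ^ 9) s (fun x ↦ by rw [hres9]; exact hr₀ _ x) hs2
  refine ⟨s, hs1, hs2, hs3, hsp, hsy, fun n hn0 hq hle e he y hy ↦ ?_⟩
  -- ### level `n`: `φ := r_e(F)⁹`
  have hn3 : ¬ 3 ∣ n := fun h3 ↦ by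
    have := hq 3 (Nat.mem_primeFactors.mpr ⟨Nat.prime_three, h3, hn0⟩)
    omega
  have h9pn0 : 9 * p * n ≠ 0 := mul_ne_zero h9p0 hn0
  haveI := (finiteDimensional_and_isGalois_ringClassField hK ι h9pn0).1
  haveI := (finiteDimensional_and_isGalois_ringClassField hK ι h9pn0).2
  obtain ⟨r, hr, hrsurj, -⟩ := exists_restrictHom hK ι h9pn0 e he
  obtain ⟨P, hP, hPmem⟩ := exists_decompositionBound_three hω h2 ι hp hp3 hn0 hn3 v₀ hv₀ e he r hr hrsurj
  set φ : ringClassField K ι (9 * p * n) ≃ₐ[K] ringClassField K ι (9 * p * n) := r (F ^ 9) with hφdef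
  have hφ9 : φ = r F ^ 9 := map_pow r F 9
  have hφ2 : φ * φ = 1 := by
    have h18 : r F ^ 18 = 1 :=
      orderOf_dvd_iff_pow_eq_one.mp ((Subgroup.orderOf_dvd_natCard P (hPmem σ)).trans hP)
    rw [hφ9, ← pow_add]; exact h18
  have hact : ∀ x : ringClassField K ι (9 * p * n), (show AlgebraicClosure K ≃ₐ[K] AlgebraicClosure K from
      resGal (K := K) (v₀.adicCompletion K) (σ ^ 9)) (e x) = e (φ x) := fun x ↦ by rw [hres9]; exact hr _ x
  refine ⟨φ, fun x ↦ ?_, ?_, hφ2, fun v hv ↦ ?_⟩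
  · -- `φ` restricts to `s` (part 1 §4; any embedding `e`)
    exact restrictHom_apply_inclusion hK ι h9p0 hle (emb (9 * p)) (hembK _) r₀ hr₀ e he r hr (F ^ 9) x
  · -- `φ` fixes `y_n`: the displayed (W2-b)
    exact hW2b p hp hp7 K ω hω h2 ι v₀ hv₀ n hn0 hq e he y hy (σ ^ 9) φ hact hφ2
  · -- the place above `3` is unique: `v = v₀`, and `res(σ⁹)` realises `φ`
    obtain rfl := HeightOneSpectrum.eq_of_three_mem hω h2 hv hv₀
    exact ⟨σ ^ 9, hact⟩

set_option maxHeartbeats 1600000 in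
/-- **`stub_layerL1Seven` MODULO {`Dt` of degree 6, #19, #20} AND THE PURE (W2-b) DISPLAY** («every involution of the
decomposition group at `w ∣ 3` fixes Hu–Shu–Yin's CM points `y₁`, `y_n`»): the stub's statement VERBATIM (= p688827
`layerL1Seven_of_named_of_flip_of_decompFixing` ∘ `decompFixing_of_involutionFixing`).  CONDITIONAL; the ledger stub stays open;
BSD is not proved by any of this. [cite: HuShuYin2019, Thm. 1.4, §2 Prop. 2.4 / Cor. 2.5, §3 p. 8, §4.1] [cite: GrossLMS1991, §3–§6]
[cite: Nekovar2007, Prop. 4.9] [cite: NeukirchANT1999, Ch. II §9 Prop. (9.6)] -/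
theorem layerL1Seven_of_named_of_flip_of_involutionFixing
    (Dt : ModularParametrizationData (⟨0, 0, 1, 0, -1⟩ : WeierstrassCurve ℚ) 243) (hdeg : Dt.deg = 6)
    (hD : shaAnPair_mul_height_eq_two_zpow_mul_height_named)
    (hES2 : Nekovar2007.cmPoint_frobeniusCongruence)
    (hW2b₁ : ∀ (p : ℕ), p.Prime → p % 9 = 7 → ∀ (K : Type) [Field K] [NumberField K] (ω : K), ω ^ 2 + ω + 1 = 0 →
      Module.finrank ℚ K = 2 → ∀ (ι : K →+* ℂ) (v : HeightOneSpectrum (𝓞 K)), ((3 : ℕ) : 𝓞 K) ∈ v.asIdeal →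
      ∀ (e : ringClassField K ι (9 * p) →+* AlgebraicClosure K),
        (∀ k : K, e (algebraMap K (ringClassField K ι (9 * p)) k) = algebraMap K (AlgebraicClosure K) k) →
      ∀ (y₁ : ((⟨0, 0, 1, 0, -1⟩ : WeierstrassCurve ℚ).baseChange (ringClassField K ι (9 * p))).toAffine.Point),
        Affine.Point.map (W' := (⟨0, 0, 1, 0, -1⟩ : WeierstrassCurve ℚ)) (ringClassField K ι (9 * p)).subtype.toRatAlgHom y₁ =
          Dt.φ (heegnerTau (81 * ((p : ℤ) ^ 2 + 4 * p + 16), -(9 * (4 * (p : ℤ) ^ 2 + 17 * p + 72)), 4 * (p : ℤ) ^ 2 + 18 * p + 81)) →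
      ∀ (τ : absoluteGaloisGroup (v.adicCompletion K)) (s : ringClassField K ι (9 * p) ≃ₐ[K] ringClassField K ι (9 * p)),
        (∀ x : ringClassField K ι (9 * p), (show AlgebraicClosure K ≃ₐ[K] AlgebraicClosure K from
          resGal (K := K) (v.adicCompletion K) τ) (e x) = e (s x)) → s * s = 1 →
        pointGalHom (⟨0, 0, 1, 0, -1⟩ : WeierstrassCurve ℚ) (ringClassField K ι (9 * p)) (s.restrictScalars ℚ) y₁ = y₁)
    (hW2b : ∀ (p : ℕ), p.Prime → p % 9 = 7 → ∀ (K : Type) [Field K] [NumberField K] (ω : K), ω ^ 2 + ω + 1 = 0 →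
      Module.finrank ℚ K = 2 → ∀ (ι : K →+* ℂ) (v : HeightOneSpectrum (𝓞 K)), ((3 : ℕ) : 𝓞 K) ∈ v.asIdeal →
      ∀ (n : ℕ), n ≠ 0 → (∀ q ∈ n.primeFactors, q % 3 = 2) →
      ∀ (e : ringClassField K ι (9 * p * n) →+* AlgebraicClosure K),
        (∀ k : K, e (algebraMap K (ringClassField K ι (9 * p * n)) k) = algebraMap K (AlgebraicClosure K) k) →
      ∀ (y : ((⟨0, 0, 1, 0, -1⟩ : WeierstrassCurve ℚ).baseChange (ringClassField K ι (9 * p * n))).toAffine.Point),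
        Affine.Point.map (W' := (⟨0, 0, 1, 0, -1⟩ : WeierstrassCurve ℚ)) (ringClassField K ι (9 * p * n)).subtype.toRatAlgHom y =
          Dt.φ (heegnerTau ((n : ℤ) ^ 2 * (81 * ((p : ℤ) ^ 2 + 4 * p + 16)),
            (n : ℤ) * (-(9 * (4 * (p : ℤ) ^ 2 + 17 * p + 72))), 4 * (p : ℤ) ^ 2 + 18 * p + 81)) →
      ∀ (τ : absoluteGaloisGroup (v.adicCompletion K))
        (φ : ringClassField K ι (9 * p * n) ≃ₐ[K] ringClassField K ι (9 * p * n)),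
        (∀ x : ringClassField K ι (9 * p * n), (show AlgebraicClosure K ≃ₐ[K] AlgebraicClosure K from
          resGal (K := K) (v.adicCompletion K) τ) (e x) = e (φ x)) → φ * φ = 1 →
        pointGalHom (⟨0, 0, 1, 0, -1⟩ : WeierstrassCurve ℚ) (ringClassField K ι (9 * p * n)) (φ.restrictScalars ℚ) y = y) :
    SylvesterTwoNonneg.HSYPointTwoDivisibleSevenModNine →
    (PublishedFactsTwoPlus →
      ∀ (p : ℕ), p.Prime → p % 9 = 7 → (¬ ∃ x : ZMod p, x ^ 3 = 3) →
        ∀ (A B : WeierstrassCurve ℚ) [A.IsElliptic] [A.IsGloballyMinimal] [B.IsElliptic]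
          [B.IsGloballyMinimal], (∃ C : VariableChange ℚ, C • B = HuShuYin2019.cubeSumCurve (p : ℚ)) →
          (∃ C : VariableChange ℚ, C • A = HuShuYin2019.cubeSumCurve (3 * (p : ℚ) ^ 2)) →
          ∀ (qB qA : ℚ), shaAn B = (qB : ℂ) → shaAn A = (qA : ℂ) → qB * qA ≠ 0 →
            padicValRat 2 (qB * qA) = 0 →
            ∀ (K : Type) [Field K] [NumberField K] (ω : K), ω ^ 2 + ω + 1 = 0 →
              Module.finrank ℚ K = 2 →
            ∀ Y₀ : ((cubeSumCurve (p : ℚ)).baseChange K).toAffine.Point,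
              (¬ ∃ Q : ((cubeSumCurve (p : ℚ)).baseChange K).toAffine.Point, (2 : ℕ) • Q = Y₀) →
            ∃ (cA : ℕ → galH1Torsion ((cubeSumCurve (3 * (p : ℚ) ^ 2)).baseChange K) (2 : ℕ))
              (cB : ℕ → galH1Torsion ((cubeSumCurve (p : ℚ)).baseChange K) (2 : ℕ)),
            (∀ ℓ, (ℓ.Prime ∧ ¬ ℓ ∣ (cubeSumCurve (3 * (p : ℚ) ^ 2)).conductorNorm ℤ ∧
                ¬ ℓ ∣ (cubeSumCurve (p : ℚ)).conductorNorm ℤ ∧ ¬ ((ℓ : ℤ) ∣ NumberField.discr K) ∧ ℓ ≠ 2 ∧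
                (Ideal.span {(ℓ : 𝓞 K)}).IsPrime ∧
                FrobEqFrobInfty (cubeSumCurve (3 * (p : ℚ) ^ 2)) K 2 ℓ ∧
                FrobEqFrobInfty (cubeSumCurve (p : ℚ)) K 2 ℓ) →
              (∀ v : HeightOneSpectrum (𝓞 K), (ℓ : 𝓞 K) ∉ v.asIdeal →
                cA ℓ ∈ selmerLocalKer ((cubeSumCurve (3 * (p : ℚ) ^ 2)).baseChange K)
                  (v.adicCompletion K) (2 : ℕ)) ∧
              (∀ x : InfinitePlace K, cA ℓ ∈ selmerLocalKer
                ((cubeSumCurve (3 * (p : ℚ) ^ 2)).baseChange K) x.Completion (2 : ℕ)) ∧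
              (∀ v : HeightOneSpectrum (𝓞 K), (ℓ : 𝓞 K) ∈ v.asIdeal →
                (cA ℓ ∈ selmerLocalKer ((cubeSumCurve (3 * (p : ℚ) ^ 2)).baseChange K)
                    (v.adicCompletion K) (2 : ℕ) ↔
                  kummerClassOfPoint (cubeSumCurve (p : ℚ)) K Nat.prime_two Y₀ ∈
                    ((cubeSumCurve (p : ℚ)).baseChange K).torsionLocalKer (v.adicCompletion K) (2 : ℕ)))) ∧
            (∀ ℓ ℓ', (ℓ.Prime ∧ ¬ ℓ ∣ (cubeSumCurve (3 * (p : ℚ) ^ 2)).conductorNorm ℤ ∧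
                ¬ ℓ ∣ (cubeSumCurve (p : ℚ)).conductorNorm ℤ ∧ ¬ ((ℓ : ℤ) ∣ NumberField.discr K) ∧ ℓ ≠ 2 ∧
                (Ideal.span {(ℓ : 𝓞 K)}).IsPrime ∧
                FrobEqFrobInfty (cubeSumCurve (3 * (p : ℚ) ^ 2)) K 2 ℓ ∧
                FrobEqFrobInfty (cubeSumCurve (p : ℚ)) K 2 ℓ) →
              (ℓ'.Prime ∧ ¬ ℓ' ∣ (cubeSumCurve (3 * (p : ℚ) ^ 2)).conductorNorm ℤ ∧
                ¬ ℓ' ∣ (cubeSumCurve (p : ℚ)).conductorNorm ℤ ∧ ¬ ((ℓ' : ℤ) ∣ NumberField.discr K) ∧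
                ℓ' ≠ 2 ∧ (Ideal.span {(ℓ' : 𝓞 K)}).IsPrime ∧
                FrobEqFrobInfty (cubeSumCurve (3 * (p : ℚ) ^ 2)) K 2 ℓ' ∧
                FrobEqFrobInfty (cubeSumCurve (p : ℚ)) K 2 ℓ') → ℓ ≠ ℓ' →
              (∀ v : HeightOneSpectrum (𝓞 K), (ℓ : 𝓞 K) ∉ v.asIdeal → (ℓ' : 𝓞 K) ∉ v.asIdeal →
                cB (ℓ * ℓ') ∈ selmerLocalKer ((cubeSumCurve (p : ℚ)).baseChange K)
                  (v.adicCompletion K) (2 : ℕ)) ∧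
              (∀ x : InfinitePlace K,
                cB (ℓ * ℓ') ∈ selmerLocalKer ((cubeSumCurve (p : ℚ)).baseChange K) x.Completion (2 : ℕ)) ∧
              (∀ v : HeightOneSpectrum (𝓞 K), (ℓ : 𝓞 K) ∈ v.asIdeal →
                (cB (ℓ * ℓ') ∈ selmerLocalKer ((cubeSumCurve (p : ℚ)).baseChange K)
                    (v.adicCompletion K) (2 : ℕ) ↔
                  cA ℓ' ∈ ((cubeSumCurve (3 * (p : ℚ) ^ 2)).baseChange K).torsionLocalKer
                    (v.adicCompletion K) (2 : ℕ))))) :=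
  layerL1Seven_of_named_of_flip_of_decompFixing Dt hdeg hD hES2 (decompFixing_of_involutionFixing Dt hW2b₁ hW2b)

/-- **THE CRUX `UpperOffV0HSYPlus` BY NAME, MODULO {`Dt` of degree 6, #19, #20, the pure (W2-b) display} AND THE TWO TAIL
STUBS** (p688827 `upperOffV0HSYPlus_of_named_of_flip_of_decompFixing_of_tails` ∘ `decompFixing_of_involutionFixing`).  A census
in the kernel: CONDITIONAL; item 19804 stays OPEN; BSD is not proved by any of this, for any curve.
[cite: HuShuYin2019, Thm. 1.4, Cor. 4.4] [cite: GrossLMS1991, §3–§6] [cite: Kolyvagin1990, §2] [cite: Nekovar2007, Prop. 4.9] -/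
theorem upperOffV0HSYPlus_of_named_of_flip_of_involutionFixing_of_tails
    (Dt : ModularParametrizationData (⟨0, 0, 1, 0, -1⟩ : WeierstrassCurve ℚ) 243) (hdeg : Dt.deg = 6)
    (hD : shaAnPair_mul_height_eq_two_zpow_mul_height_named)
    (hES2 : Nekovar2007.cmPoint_frobeniusCongruence)
    (hW2b₁ : ∀ (p : ℕ), p.Prime → p % 9 = 7 → ∀ (K : Type) [Field K] [NumberField K] (ω : K), ω ^ 2 + ω + 1 = 0 →
      Module.finrank ℚ K = 2 → ∀ (ι : K →+* ℂ) (v : HeightOneSpectrum (𝓞 K)), ((3 : ℕ) : 𝓞 K) ∈ v.asIdeal →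
      ∀ (e : ringClassField K ι (9 * p) →+* AlgebraicClosure K),
        (∀ k : K, e (algebraMap K (ringClassField K ι (9 * p)) k) = algebraMap K (AlgebraicClosure K) k) →
      ∀ (y₁ : ((⟨0, 0, 1, 0, -1⟩ : WeierstrassCurve ℚ).baseChange (ringClassField K ι (9 * p))).toAffine.Point),
        Affine.Point.map (W' := (⟨0, 0, 1, 0, -1⟩ : WeierstrassCurve ℚ)) (ringClassField K ι (9 * p)).subtype.toRatAlgHom y₁ =
          Dt.φ (heegnerTau (81 * ((p : ℤ) ^ 2 + 4 * p + 16), -(9 * (4 * (p : ℤ) ^ 2 + 17 * p + 72)), 4 * (p : ℤ) ^ 2 + 18 * p + 81)) →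
      ∀ (τ : absoluteGaloisGroup (v.adicCompletion K)) (s : ringClassField K ι (9 * p) ≃ₐ[K] ringClassField K ι (9 * p)),
        (∀ x : ringClassField K ι (9 * p), (show AlgebraicClosure K ≃ₐ[K] AlgebraicClosure K from
          resGal (K := K) (v.adicCompletion K) τ) (e x) = e (s x)) → s * s = 1 →
        pointGalHom (⟨0, 0, 1, 0, -1⟩ : WeierstrassCurve ℚ) (ringClassField K ι (9 * p)) (s.restrictScalars ℚ) y₁ = y₁)
    (hW2b : ∀ (p : ℕ), p.Prime → p % 9 = 7 → ∀ (K : Type) [Field K] [NumberField K] (ω : K), ω ^ 2 + ω + 1 = 0 →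
      Module.finrank ℚ K = 2 → ∀ (ι : K →+* ℂ) (v : HeightOneSpectrum (𝓞 K)), ((3 : ℕ) : 𝓞 K) ∈ v.asIdeal →
      ∀ (n : ℕ), n ≠ 0 → (∀ q ∈ n.primeFactors, q % 3 = 2) →
      ∀ (e : ringClassField K ι (9 * p * n) →+* AlgebraicClosure K),
        (∀ k : K, e (algebraMap K (ringClassField K ι (9 * p * n)) k) = algebraMap K (AlgebraicClosure K) k) →
      ∀ (y : ((⟨0, 0, 1, 0, -1⟩ : WeierstrassCurve ℚ).baseChange (ringClassField K ι (9 * p * n))).toAffine.Point),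
        Affine.Point.map (W' := (⟨0, 0, 1, 0, -1⟩ : WeierstrassCurve ℚ)) (ringClassField K ι (9 * p * n)).subtype.toRatAlgHom y =
          Dt.φ (heegnerTau ((n : ℤ) ^ 2 * (81 * ((p : ℤ) ^ 2 + 4 * p + 16)),
            (n : ℤ) * (-(9 * (4 * (p : ℤ) ^ 2 + 17 * p + 72))), 4 * (p : ℤ) ^ 2 + 18 * p + 81)) →
      ∀ (τ : absoluteGaloisGroup (v.adicCompletion K))
        (φ : ringClassField K ι (9 * p * n) ≃ₐ[K] ringClassField K ι (9 * p * n)),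
        (∀ x : ringClassField K ι (9 * p * n), (show AlgebraicClosure K ≃ₐ[K] AlgebraicClosure K from
          resGal (K := K) (v.adicCompletion K) τ) (e x) = e (φ x)) → φ * φ = 1 →
        pointGalHom (⟨0, 0, 1, 0, -1⟩ : WeierstrassCurve ℚ) (ringClassField K ι (9 * p * n)) (φ.restrictScalars ℚ) y = y)
    (htailFour : PublishedFactsTwoPlus →
    ∀ (p : ℕ), p.Prime → p % 9 = 4 → (¬ ∃ x : ZMod p, x ^ 3 = 3) →
      ∀ (A B : WeierstrassCurve ℚ) [A.IsElliptic] [A.IsGloballyMinimal] [B.IsElliptic]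
        [B.IsGloballyMinimal], (∃ C : VariableChange ℚ, C • B = HuShuYin2019.cubeSumCurve (p : ℚ)) →
        (∃ C : VariableChange ℚ, C • A = HuShuYin2019.cubeSumCurve (3 * (p : ℚ) ^ 2)) →
        4 < Nat.card (AddCommGroup.primaryComponent B.sha 2) *
            Nat.card (AddCommGroup.primaryComponent A.sha 2) →
        ∃ qB qA : ℚ, shaAn B = (qB : ℂ) ∧ shaAn A = (qA : ℂ) ∧ qB * qA ≠ 0 ∧
          (padicValNat 2 (Nat.card (AddCommGroup.primaryComponent B.sha 2)) : ℤ) +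
              (padicValNat 2 (Nat.card (AddCommGroup.primaryComponent A.sha 2)) : ℤ) ≤
            padicValRat 2 (qB * qA))
    (htailSeven : PublishedFactsTwoPlus →
    ∀ (p : ℕ), p.Prime → p % 9 = 7 → (¬ ∃ x : ZMod p, x ^ 3 = 3) →
      ∀ (A B : WeierstrassCurve ℚ) [A.IsElliptic] [A.IsGloballyMinimal] [B.IsElliptic]
        [B.IsGloballyMinimal], (∃ C : VariableChange ℚ, C • B = HuShuYin2019.cubeSumCurve (p : ℚ)) →
        (∃ C : VariableChange ℚ, C • A = HuShuYin2019.cubeSumCurve (3 * (p : ℚ) ^ 2)) →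
        4 < Nat.card (AddCommGroup.primaryComponent B.sha 2) *
            Nat.card (AddCommGroup.primaryComponent A.sha 2) →
        ∃ qB qA : ℚ, shaAn B = (qB : ℂ) ∧ shaAn A = (qA : ℂ) ∧ qB * qA ≠ 0 ∧
          (padicValNat 2 (Nat.card (AddCommGroup.primaryComponent B.sha 2)) : ℤ) +
              (padicValNat 2 (Nat.card (AddCommGroup.primaryComponent A.sha 2)) : ℤ) ≤
            padicValRat 2 (qB * qA)) :
    Summit.BirchSwinnertonDyer.BirchSwinnertonDyer.Theses.SylvesterTwoHeegnerIndex.UpperOffV0HSYPlus :=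
  upperOffV0HSYPlus_of_named_of_flip_of_decompFixing_of_tails Dt hdeg hD hES2
    (decompFixing_of_involutionFixing Dt hW2b₁ hW2b) htailFour htailSeven

end Summit.BirchSwinnertonDyer.BirchSwinnertonDyer.Theorems.SylvesterTwoCMHalf

end
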